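import Mathlib
import HarnessLib
import Summits.HubbardSuperconductivity.HubbardSuperconductivity.Theorems.KLProgrammeKLRegimeSplitEdgeFactsTransferLines

/-!
# Route `KLProgramme` — ENGINE child gen 8 (stmt-HubbardSuperconductivity-20437 `KLRegimeEngineV17F2`), skeleton v2 class #5 / stub (c): the MODEL LINES of the
# two SLICE WEIGHTS of the class-#5 composition — MASS `Σ_p |w| ≤ 2^18` and SIGN `w ≥ 0` deep inside the class (`Σ_p (|w| − w) ≤ 2·klEdge`) for the PLAIN
# slice weight `klSliceWeightPlain … (n+1)` and the SMEARED slice weight `klSliceWeightSmeared … (n+1) φ`, n-UNIFORMLY on every admissible frame (cell gate-hubbard-kl, seat p1 g12)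

WHY.  The class-#5 re-export of a member at the new scale (`kltc_transfer_compose_fwd_on[_repin]`, k3c1 p540411/`…PairLadderRepin`) composes three resolvent
relations with the weights `b′ = t_n[φ + s_{n+1}]` (history, pinned), `w` (plain step, `1 + diag w·C₀`) and `w₁` (the member's Wick tower, `1 + diag w₁·X`) and
re-keys the composite `b′ + w − w₁` to the pinned `t_{n+1}[φ]` with `δ = 0` exactly when `w = klSliceWeightPlain … (n+1)` and `w₁ = klSliceWeightSmeared … (n+1) φ`
(`klTransferWeight_succ`, p577392).  Its smallness inputs `(m+e)·Σ|w + b′| ≤ 1/3`, `((3/2)m + e₁)·Σ|w₁| ≤ 1/3` and the (E2-F2) slot's own two lines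
`Σ|w| ≤ G.bhi`, `Σ(|w| − w) ≤ 2·klEdge G (n+1) |Qm|_𝕋` therefore want the MASS and SIGN lines of these two model weights — this file, by the product bound of
`…SplitEdgeFactsTransferLines` (hard line `≤ 2/Λ`, soft phase-space sum `≤ 15367·Λ·βL²`, p580182/p579393), never AM–GM:
* §1 generic: `abs_klBubbleMass_le`, **`sum_abs_klBubbleMass_le_of_left/_of_right`** (`Σ_p |B(a,b)(Qm,p)| ≤ (βL²)⁻¹·A·Σ_k |b(k)|‖ĝ_K(k)‖` when `|a|‖ĝ_K‖ ≤ A`, and the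
  mirror form), `klBubbleMass_nonneg_of_hard_left/_right` (deep inside the class, `a, b ≥ 0`, one symbol supported on `{ω² + e_K² ≥ Λ²/4}` ⇒ `B(a,b) ≥ 0` pointwise);
* §2 the slice symbol `s_{n+1} = w_{Λ_{n+1}} − w_{Λ_n}`: `0 ≤ s ≤ w_{Λ_{n+1}}`, `s·‖ĝ‖ ≤ 2/Λ_{n+1}` (hard at `n+1`), `s ≤ 1 − w_{Λ_n}` (soft at `n`), hardness of its support;
  the soft sum `Σ_k φ(k)‖ĝ_K(k)‖ ≤ 15367·Λ_n·βL²` for `0 ≤ φ ≤ 1 − w_{Λ_n}` at EVERY `n` (`sum_softSymbol_mul_norm_propCT_le_of_frameOK`);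
* §3 PLAIN: `klSliceWeightPlain_succ_eq_bubbleMass` (`w_{n+1} = B(w_{Λ_n}, s) + B(s, w_{Λ_{n+1}})`), **`sum_abs_klSliceWeightPlain_succ_le`** (`≤ 2^18`: `2·15367 + 8·15367`),
  `klSliceWeightPlain_zero` (`= 0`), `klSliceWeightPlain_succ_nonneg_of_deep`, **`sum_abs_sub_self_klSliceWeightPlain_succ_le`** (`2^18 ≤ G.bhi ⇒ Σ(|w| − w) ≤ 2·klEdge G (n+1) |Qm|_𝕋`);
* §4 SMEARED: `klSliceWeightSmeared_succ_eq_bubbleMass` (`w₁ = B(s, φ + s) + B(φ, s)`), **`sum_abs_klSliceWeightSmeared_succ_le`** (`≤ 2^18`), `klSliceWeightSmeared_zero`,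
  `klSliceWeightSmeared_succ_nonneg_of_deep`, **`sum_abs_sub_self_klSliceWeightSmeared_succ_le`**.
Everything is proved; no definition; nothing about the effective action is asserted.  0 kit.
-/

noncomputable section

namespace Summit.HubbardSuperconductivity.HubbardSuperconductivity.Theorems.KLRegimeSplit

set_option linter.dupNamespace false -- summit = problem name (single-conjunct summit), D-0017

open Real Finset Complex Literature.MathematicalPhysics.QuantumLattice Literature.Probability.LatticeModels
open Summit.HubbardSuperconductivity.HubbardSuperconductivity.Theorems.KLProgrammeLegKernels
open Summit.HubbardSuperconductivity.HubbardSuperconductivity.Theorems.TwoPointAssembly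

/-! ## §1 Generic bubble-mass bounds: one bounded line times one summed line; positivity deep inside the class -/

section Generic

variable {L M : ℕ} [NeZero L] (β μ : ℝ) (K : TrigPolyC4v)

omit [NeZero L] in
/-- **Termwise**: `|B(a,b)(Qm,p)| ≤ (βL²)⁻¹·Σ_ν |a(ν,p)|‖ĝ(ν,p)‖·|b(−ν,Qm−p)|‖ĝ(−ν,Qm−p)‖` (`0 < β`). -/
theorem abs_klBubbleMass_le (hβ : 0 < β) (a b : FreqMomentum L M → ℝ) (Qm p : TorusSite 2 L) :
    |klBubbleMass L M β μ K a b Qm p| ≤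
      (β * (L : ℝ) ^ 2)⁻¹ * ∑ ν : MatsubaraIdx M,
        (|a (ν, p)| * ‖propCT L M β μ K (ν, p)‖) * (|b (ν.rev, Qm - p)| * ‖propCT L M β μ K (ν.rev, Qm - p)‖) := by
  have hc : 0 ≤ (β * (L : ℝ) ^ 2)⁻¹ := by positivity
  rw [klBubbleMass, klBubbleSum, abs_mul, abs_of_nonneg hc]
  refine mul_le_mul_of_nonneg_left ?_ hc
  refine (Complex.abs_re_le_norm _).trans ((norm_sum_le _ _).trans (le_of_eq (sum_congr rfl fun ν _ => ?_)))
  rw [norm_mul, norm_mul, Complex.norm_real, Real.norm_eq_abs, abs_mul]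
  ring

/-- **Mass, bounded LEFT line**: `|a(k)|‖ĝ_K(k)‖ ≤ A` everywhere ⇒ `Σ_p |B(a,b)(Qm,p)| ≤ (βL²)⁻¹·A·Σ_k |b(k)|‖ĝ_K(k)‖` (the partner reindexed by
`(ν,p) ↦ (−ν, Qm − p)`). -/
theorem sum_abs_klBubbleMass_le_of_left (hβ : 0 < β) {a : FreqMomentum L M → ℝ} (b : FreqMomentum L M → ℝ) {A : ℝ}
    (hA : ∀ k, |a k| * ‖propCT L M β μ K k‖ ≤ A) (Qm : TorusSite 2 L) :
    ∑ p, |klBubbleMass L M β μ K a b Qm p| ≤ (β * (L : ℝ) ^ 2)⁻¹ * A * ∑ k : FreqMomentum L M, |b k| * ‖propCT L M β μ K k‖ := by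
  have hc : 0 ≤ (β * (L : ℝ) ^ 2)⁻¹ := by positivity
  set soft : FreqMomentum L M → ℝ := fun k => |b k| * ‖propCT L M β μ K k‖ with hsoft
  have hsoft0 : ∀ k, 0 ≤ soft k := fun k => mul_nonneg (abs_nonneg _) (norm_nonneg _)
  have hreindex : ∑ p : TorusSite 2 L, ∑ ν : MatsubaraIdx M, soft (ν.rev, Qm - p) = ∑ k, soft k := by
    have h1 : ∀ p : TorusSite 2 L, ∑ ν : MatsubaraIdx M, soft (ν.rev, Qm - p) = ∑ ν : MatsubaraIdx M, soft (ν, Qm - p) := fun p =>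
      Equiv.sum_comp Fin.revPerm (fun ν => soft (ν, Qm - p))
    simp_rw [h1]
    have h2 : ∑ p : TorusSite 2 L, ∑ ν : MatsubaraIdx M, soft (ν, Qm - p) = ∑ p : TorusSite 2 L, ∑ ν : MatsubaraIdx M, soft (ν, p) :=
      Fintype.sum_equiv (Equiv.subLeft Qm) _ _ fun p => rfl
    rw [h2, Fintype.sum_prod_type, sum_comm]
  calc ∑ p, |klBubbleMass L M β μ K a b Qm p|
      ≤ ∑ p, (β * (L : ℝ) ^ 2)⁻¹ * ∑ ν : MatsubaraIdx M, A * soft (ν.rev, Qm - p) := by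
        refine sum_le_sum fun p _ => (abs_klBubbleMass_le β μ K hβ a b Qm p).trans ?_
        refine mul_le_mul_of_nonneg_left (sum_le_sum fun ν _ => ?_) hc
        exact mul_le_mul_of_nonneg_right (hA _) (hsoft0 _)
    _ = (β * (L : ℝ) ^ 2)⁻¹ * A * ∑ p : TorusSite 2 L, ∑ ν : MatsubaraIdx M, soft (ν.rev, Qm - p) := by
        simp only [Finset.mul_sum, mul_assoc]
    _ = (β * (L : ℝ) ^ 2)⁻¹ * A * ∑ k, soft k := by rw [hreindex]

/-- **Mass, bounded RIGHT line**: `|b(k)|‖ĝ_K(k)‖ ≤ A` everywhere ⇒ `Σ_p |B(a,b)(Qm,p)| ≤ (βL²)⁻¹·A·Σ_k |a(k)|‖ĝ_K(k)‖`. -/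
theorem sum_abs_klBubbleMass_le_of_right (hβ : 0 < β) (a : FreqMomentum L M → ℝ) {b : FreqMomentum L M → ℝ} {A : ℝ}
    (hA : ∀ k, |b k| * ‖propCT L M β μ K k‖ ≤ A) (Qm : TorusSite 2 L) :
    ∑ p, |klBubbleMass L M β μ K a b Qm p| ≤ (β * (L : ℝ) ^ 2)⁻¹ * A * ∑ k : FreqMomentum L M, |a k| * ‖propCT L M β μ K k‖ := by
  have hc : 0 ≤ (β * (L : ℝ) ^ 2)⁻¹ := by positivity
  set soft : FreqMomentum L M → ℝ := fun k => |a k| * ‖propCT L M β μ K k‖ with hsoft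
  have hsoft0 : ∀ k, 0 ≤ soft k := fun k => mul_nonneg (abs_nonneg _) (norm_nonneg _)
  have hplain : ∑ p : TorusSite 2 L, ∑ ν : MatsubaraIdx M, soft (ν, p) = ∑ k, soft k := by
    rw [Fintype.sum_prod_type, sum_comm]
  calc ∑ p, |klBubbleMass L M β μ K a b Qm p|
      ≤ ∑ p, (β * (L : ℝ) ^ 2)⁻¹ * ∑ ν : MatsubaraIdx M, A * soft (ν, p) := by
        refine sum_le_sum fun p _ => (abs_klBubbleMass_le β μ K hβ a b Qm p).trans ?_
        refine mul_le_mul_of_nonneg_left (sum_le_sum fun ν _ => ?_) hc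
        exact (mul_le_mul_of_nonneg_left (hA _) (hsoft0 _)).trans (le_of_eq (mul_comm _ _))
    _ = (β * (L : ℝ) ^ 2)⁻¹ * A * ∑ p : TorusSite 2 L, ∑ ν : MatsubaraIdx M, soft (ν, p) := by
        simp only [Finset.mul_sum, mul_assoc]
    _ = (β * (L : ℝ) ^ 2)⁻¹ * A * ∑ k, soft k := by rw [hplain]

omit [NeZero L] in
/-- A nonvanishing scale weight sits on or above its slice: `w^K_Λ(k) ≠ 0 ⇒ Λ²/4 ≤ ω² + e_K²` (`0 < Λ`). -/
theorem sq_le_of_hubbardCutoffWeightCT_ne_zero {Λ : ℝ} (hΛ : 0 < Λ) {k : FreqMomentum L M} (h : hubbardCutoffWeightCT L M β μ K Λ k ≠ 0) :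
    Λ ^ 2 / 4 ≤ matsubaraFreq β M k.1 ^ 2 + nambuXiCT L μ K k.2 ^ 2 := by
  by_contra hlt
  push Not at hlt
  exact h (salmhoferCutoff_of_le (by rw [div_le_iff₀ (by positivity)]; linarith))

variable {R : RenConsts} {U : ℝ} {N : ℕ}

/-- **Positivity deep inside the class, hard LEFT symbol**: on an admissible frame, `a, b ≥ 0`, `a` supported on `{Λ²/4 ≤ ω² + e_K²}`, and
`klEdgeKappa·|Qm|_𝕋 ≤ Λ` ⇒ `0 ≤ B(a,b)(Qm,p)` for every `p` (each rung has nonnegative real part: `kled_pairWeight_re_nonneg_of_slice` with the deep gap). -/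
theorem klBubbleMass_nonneg_of_hard_left (hK : FrameOK R U N μ K) (hβ : 0 < β) {Λ : ℝ} {a b : FreqMomentum L M → ℝ} (ha : ∀ k, 0 ≤ a k)
    (hb : ∀ k, 0 ≤ b k) (hah : ∀ k, a k ≠ 0 → Λ ^ 2 / 4 ≤ matsubaraFreq β M k.1 ^ 2 + nambuXiCT L μ K k.2 ^ 2) {Qm : TorusSite 2 L}
    (hdeep : klEdgeKappa * klTorusNorm L Qm ≤ Λ) (p : TorusSite 2 L) : 0 ≤ klBubbleMass L M β μ K a b Qm p := by
  have hc : 0 ≤ (β * (L : ℝ) ^ 2)⁻¹ := by positivity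
  rw [klBubbleMass, klBubbleSum]
  refine mul_nonneg hc ?_
  rw [re_sum]
  refine sum_nonneg fun ν _ => ?_
  set ω := matsubaraFreq β M ν with hω
  set e₁ := nambuXiCT L μ K p with he₁
  set e₂ := nambuXiCT L μ K (Qm - p) with he₂
  have hgap : |e₁ - e₂| ≤ Λ / 2 := kled_gap_deep_of_frameOK hK p Qm hdeep
  have hab : 0 ≤ a (ν, p) * b (ν.rev, Qm - p) := mul_nonneg (ha (ν, p)) (hb (ν.rev, Qm - p))
  rw [mul_comm, propCT_mul_propCT_rev, ← hω, ← he₁, ← he₂, one_div, ← div_eq_inv_mul]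
  by_cases hs : 0 ≤ ω ^ 2 + e₁ * e₂
  · exact kled_pairWeight_re_nonneg hab hs
  · have h0 : a (ν, p) = 0 := by
      by_contra hne
      exact hs (kled_sq_add_mul_nonneg (hah (ν, p) hne) hgap)
    rw [h0, zero_mul, Complex.ofReal_zero, zero_div, Complex.zero_re]

/-- **Positivity deep inside the class, hard RIGHT symbol** (the partner `b(−ν, Qm−p)` on or above the slice; `kled_sq_add_mul_nonneg'`). -/
theorem klBubbleMass_nonneg_of_hard_right (hK : FrameOK R U N μ K) (hβ : 0 < β) {Λ : ℝ} {a b : FreqMomentum L M → ℝ} (ha : ∀ k, 0 ≤ a k)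
    (hb : ∀ k, 0 ≤ b k) (hbh : ∀ k, b k ≠ 0 → Λ ^ 2 / 4 ≤ matsubaraFreq β M k.1 ^ 2 + nambuXiCT L μ K k.2 ^ 2) {Qm : TorusSite 2 L}
    (hdeep : klEdgeKappa * klTorusNorm L Qm ≤ Λ) (p : TorusSite 2 L) : 0 ≤ klBubbleMass L M β μ K a b Qm p := by
  have hc : 0 ≤ (β * (L : ℝ) ^ 2)⁻¹ := by positivity
  rw [klBubbleMass, klBubbleSum]
  refine mul_nonneg hc ?_
  rw [re_sum]
  refine sum_nonneg fun ν _ => ?_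
  set ω := matsubaraFreq β M ν with hω
  set e₁ := nambuXiCT L μ K p with he₁
  set e₂ := nambuXiCT L μ K (Qm - p) with he₂
  have hgap : |e₁ - e₂| ≤ Λ / 2 := kled_gap_deep_of_frameOK hK p Qm hdeep
  have hab : 0 ≤ a (ν, p) * b (ν.rev, Qm - p) := mul_nonneg (ha (ν, p)) (hb (ν.rev, Qm - p))
  rw [mul_comm, propCT_mul_propCT_rev, ← hω, ← he₁, ← he₂, one_div, ← div_eq_inv_mul]
  by_cases hs : 0 ≤ ω ^ 2 + e₁ * e₂
  · exact kled_pairWeight_re_nonneg hab hs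
  · have h0 : b (ν.rev, Qm - p) = 0 := by
      by_contra hne
      have h2 := hbh (ν.rev, Qm - p) hne
      simp only [matsubaraFreq_rev, neg_sq, ← hω, ← he₂] at h2
      exact hs (kled_sq_add_mul_nonneg' h2 hgap)
    rw [h0, mul_zero, Complex.ofReal_zero, zero_div, Complex.zero_re]

end Generic

/-! ## §2 The slice symbol `s_{n+1} = w_{Λ_{n+1}} − w_{Λ_n}` and the soft sums -/

section Slice

variable {L M : ℕ} [NeZero L] (β μ : ℝ) (K : TrigPolyC4v)

omit [NeZero L] in
/-- `0 ≤ s_{n+1} ≤ w_{Λ_{n+1}}`. -/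
theorem softSymbolCompl_succ_mem (n : ℕ) (k : FreqMomentum L M) :
    0 ≤ softSymbolCompl L M β μ K n (n + 1) k ∧ softSymbolCompl L M β μ K n (n + 1) k ≤ hubbardCutoffWeightCT L M β μ K (klScale klE0 (n + 1)) k := by
  refine ⟨((isSoftSymbol_compl (L := L) (M := M) β μ K (Nat.le_succ n)).1 k).1, ?_⟩
  have h0 : 0 ≤ hubbardCutoffWeightCT L M β μ K (klScale klE0 n) k := (salmhoferCutoff_mem_Icc _).1
  unfold softSymbolCompl
  linarith

omit [NeZero L] in
/-- **The slice symbol is HARD at scale `n+1`**: `s_{n+1}(k)·‖ĝ_K(k)‖ ≤ 2/Λ_{n+1}`. -/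
theorem softSymbolCompl_succ_mul_norm_propCT_le (n : ℕ) (k : FreqMomentum L M) :
    |softSymbolCompl L M β μ K n (n + 1) k| * ‖propCT L M β μ K k‖ ≤ 2 / klScale klE0 (n + 1) := by
  obtain ⟨h0, h1⟩ := softSymbolCompl_succ_mem β μ K n k
  rw [abs_of_nonneg h0]
  exact (mul_le_mul_of_nonneg_right h1 (norm_nonneg _)).trans
    (hubbardCutoffWeightCT_mul_norm_propCT_le β μ K (klth_klScale_pos (n + 1)) k)

omit [NeZero L] in
/-- A scale weight is hard at its own scale: `|w^K_Λ(k)|·‖ĝ_K(k)‖ ≤ 2/Λ`. -/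
theorem abs_hubbardCutoffWeightCT_mul_norm_propCT_le {Λ : ℝ} (hΛ : 0 < Λ) (k : FreqMomentum L M) :
    |hubbardCutoffWeightCT L M β μ K Λ k| * ‖propCT L M β μ K k‖ ≤ 2 / Λ := by
  have h0 : 0 ≤ hubbardCutoffWeightCT L M β μ K Λ k := (salmhoferCutoff_mem_Icc _).1
  rw [abs_of_nonneg h0]
  exact hubbardCutoffWeightCT_mul_norm_propCT_le β μ K hΛ k

omit [NeZero L] in
/-- The support of the slice symbol lies on or above slice `n+1`: `s_{n+1}(k) ≠ 0 ⇒ Λ_{n+1}²/4 ≤ ω² + e_K²`. -/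
theorem sq_le_of_softSymbolCompl_succ_ne_zero (n : ℕ) {k : FreqMomentum L M} (h : softSymbolCompl L M β μ K n (n + 1) k ≠ 0) :
    klScale klE0 (n + 1) ^ 2 / 4 ≤ matsubaraFreq β M k.1 ^ 2 + nambuXiCT L μ K k.2 ^ 2 := by
  refine sq_le_of_hubbardCutoffWeightCT_ne_zero β μ K (klth_klScale_pos (n + 1)) fun hw => h ?_
  obtain ⟨h0, h1⟩ := softSymbolCompl_succ_mem β μ K n k
  rw [hw] at h1
  linarith

omit [NeZero L] in
/-- A weight hard at `Λ_n` is hard at `Λ_{n+1}`: `w_{Λ_n}(k) ≠ 0 ⇒ Λ_{n+1}²/4 ≤ ω² + e_K²`. -/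
theorem sq_succ_le_of_hubbardCutoffWeightCT_ne_zero (n : ℕ) {k : FreqMomentum L M}
    (h : hubbardCutoffWeightCT L M β μ K (klScale klE0 n) k ≠ 0) :
    klScale klE0 (n + 1) ^ 2 / 4 ≤ matsubaraFreq β M k.1 ^ 2 + nambuXiCT L μ K k.2 ^ 2 := by
  have h1 := sq_le_of_hubbardCutoffWeightCT_ne_zero β μ K (klth_klScale_pos n) h
  have h2 : klScale klE0 (n + 1) ≤ klScale klE0 n := by
    rw [klth_klScale_succ]; linarith [klth_klScale_pos n]
  have h3 : klScale klE0 (n + 1) ^ 2 ≤ klScale klE0 n ^ 2 := pow_le_pow_left₀ (klth_klScale_pos (n + 1)).le h2 2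
  linarith

variable {R : RenConsts} {U : ℝ} {N : ℕ}

/-- **The soft sum of a symbol at scale `n`**: on an admissible frame, `klBetaMin ≤ β ≤ L`, `0 ≤ φ ≤ 1 − w_{Λ_n}` ⇒ `Σ_k |φ(k)|·‖ĝ_K(k)‖ ≤ 15367·Λ_n·βL²`
(at every `n`: below the temperature the symbol vanishes). -/
theorem sum_softSymbol_mul_norm_propCT_le_of_frameOK (hK : FrameOK R U N μ K) (hβ : klBetaMin ≤ β) (hβL : β ≤ L) (n : ℕ)
    {φ : FreqMomentum L M → ℝ} (hφ : ∀ k, 0 ≤ φ k ∧ φ k ≤ 1 - hubbardCutoffWeightCT L M β μ K (klScale klE0 n) k) :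
    ∑ k : FreqMomentum L M, |φ k| * ‖propCT L M β μ K k‖ ≤ 15367 * klScale klE0 n * β * (L : ℝ) ^ 2 := by
  have hβ0 : 0 < β := pos_of_klBetaMin_le hβ
  have hΛ : 0 < klScale klE0 n := klth_klScale_pos n
  have hL : (0 : ℝ) < L := lt_of_lt_of_le hβ0 hβL
  rcases le_or_gt (Real.pi / β) (klScale klE0 n) with hth | hth
  · calc ∑ k : FreqMomentum L M, |φ k| * ‖propCT L M β μ K k‖
        ≤ ∑ k : FreqMomentum L M, (1 - hubbardCutoffWeightCT L M β μ K (klScale klE0 n) k) /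
            Real.sqrt (matsubaraFreq β M k.1 ^ 2 + nambuXiCT L μ K k.2 ^ 2) :=
          sum_le_sum fun k _ => by rw [abs_of_nonneg (hφ k).1]; exact softSymbol_mul_norm_propCT_le β μ K hφ k
      _ ≤ 15367 * klScale klE0 n * β * (L : ℝ) ^ 2 := sum_softLine_le_of_frameOK (M := M) hK hβ0 hβL hth
  · have hφ0 : ∀ k, φ k = 0 := softSymbol_eq_zero_of_lt_pi_div β μ K hβ0 hΛ hth hφ
    simp only [hφ0, abs_zero, zero_mul, sum_const_zero]
    positivity

/-- The slice symbol `s_{n+1}` is SOFT at scale `n`: `0 ≤ s_{n+1} ≤ 1 − w_{Λ_n}`; so `Σ_k |s_{n+1}(k)|·‖ĝ_K(k)‖ ≤ 15367·Λ_n·βL²`. -/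
theorem sum_softSymbolCompl_succ_mul_norm_propCT_le (hK : FrameOK R U N μ K) (hβ : klBetaMin ≤ β) (hβL : β ≤ L) (n : ℕ) :
    ∑ k : FreqMomentum L M, |softSymbolCompl L M β μ K n (n + 1) k| * ‖propCT L M β μ K k‖ ≤ 15367 * klScale klE0 n * β * (L : ℝ) ^ 2 :=
  sum_softSymbol_mul_norm_propCT_le_of_frameOK β μ K hK hβ hβL n (isSoftSymbol_compl (L := L) (M := M) β μ K (Nat.le_succ n)).1

end Slice

/-! ## §3 The PLAIN slice weight `w_{n+1} = B(w_{Λ_n}, s_{n+1}) + B(s_{n+1}, w_{Λ_{n+1}})` -/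

section Plain

variable {L M : ℕ} [NeZero L] (β μ : ℝ) (K : TrigPolyC4v)

omit [NeZero L] in
/-- At the top there is no slice: `klSliceWeightPlain … 0 = 0` (ℕ-subtraction). -/
theorem klSliceWeightPlain_zero (Qm p : TorusSite 2 L) : klSliceWeightPlain L M β μ K 0 Qm p = 0 := by
  simp [klSliceWeightPlain]

omit [NeZero L] in
/-- **The plain slice weight as two bubbles, one line the slice symbol**: `w_{n+1} = B(w_{Λ_n}, s_{n+1}) + B(s_{n+1}, w_{Λ_{n+1}})`. -/
theorem klSliceWeightPlain_succ_eq_bubbleMass (n : ℕ) (Qm p : TorusSite 2 L) :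
    klSliceWeightPlain L M β μ K (n + 1) Qm p =
      klBubbleMass L M β μ K (hubbardCutoffWeightCT L M β μ K (klScale klE0 n)) (softSymbolCompl L M β μ K n (n + 1)) Qm p +
        klBubbleMass L M β μ K (softSymbolCompl L M β μ K n (n + 1)) (hubbardCutoffWeightCT L M β μ K (klScale klE0 (n + 1))) Qm p := by
  rw [klSliceWeightPlain, Nat.add_sub_cancel]
  conv_lhs => rw [hubbardCutoffWeightCT_succ_eq_add_compl β μ K n]
  rw [klBubbleMass_add_left, klBubbleMass_add_right, ← hubbardCutoffWeightCT_succ_eq_add_compl β μ K n]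
  ring

variable {R : RenConsts} {U : ℝ} {N : ℕ}

/-- **MASS LINE of the plain slice weight**: `FrameOK R U N μ K → klBetaMin ≤ β → β ≤ L → Σ_p |klSliceWeightPlain … (n+1) Qm p| ≤ 2^18` at every `n`, every `Qm`
(`(2/Λ_n)·15367Λ_n + (2/Λ_{n+1})·15367Λ_n = 10·15367`). -/
theorem sum_abs_klSliceWeightPlain_succ_le (hK : FrameOK R U N μ K) (hβ : klBetaMin ≤ β) (hβL : β ≤ L) (n : ℕ) (Qm : TorusSite 2 L) :
    ∑ p, |klSliceWeightPlain L M β μ K (n + 1) Qm p| ≤ 2 ^ 18 := by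
  have hβ0 : 0 < β := pos_of_klBetaMin_le hβ
  have hL : (0 : ℝ) < L := lt_of_lt_of_le hβ0 hβL
  have hΛ : 0 < klScale klE0 n := klth_klScale_pos n
  have hΛ' : 0 < klScale klE0 (n + 1) := klth_klScale_pos (n + 1)
  have hsucc : klScale klE0 (n + 1) = klScale klE0 n / 4 := klth_klScale_succ n
  have hS := sum_softSymbolCompl_succ_mul_norm_propCT_le (M := M) β μ K hK hβ hβL n
  have hc : 0 ≤ (β * (L : ℝ) ^ 2)⁻¹ := by positivity
  have h1 := sum_abs_klBubbleMass_le_of_left β μ K hβ0 (softSymbolCompl L M β μ K n (n + 1))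
    (abs_hubbardCutoffWeightCT_mul_norm_propCT_le β μ K hΛ) Qm
  have h2 := sum_abs_klBubbleMass_le_of_right β μ K hβ0 (softSymbolCompl L M β μ K n (n + 1))
    (abs_hubbardCutoffWeightCT_mul_norm_propCT_le β μ K hΛ') Qm
  have hne : β * (L : ℝ) ^ 2 ≠ 0 := by positivity
  calc ∑ p, |klSliceWeightPlain L M β μ K (n + 1) Qm p|
      ≤ ∑ p, (|klBubbleMass L M β μ K (hubbardCutoffWeightCT L M β μ K (klScale klE0 n)) (softSymbolCompl L M β μ K n (n + 1)) Qm p| +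
          |klBubbleMass L M β μ K (softSymbolCompl L M β μ K n (n + 1)) (hubbardCutoffWeightCT L M β μ K (klScale klE0 (n + 1))) Qm p|) :=
        sum_le_sum fun p _ => by rw [klSliceWeightPlain_succ_eq_bubbleMass]; exact abs_add_le _ _
    _ ≤ (β * (L : ℝ) ^ 2)⁻¹ * (2 / klScale klE0 n) * (15367 * klScale klE0 n * β * (L : ℝ) ^ 2) +
          (β * (L : ℝ) ^ 2)⁻¹ * (2 / klScale klE0 (n + 1)) * (15367 * klScale klE0 n * β * (L : ℝ) ^ 2) := by
        rw [sum_add_distrib]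
        exact add_le_add (h1.trans (mul_le_mul_of_nonneg_left hS (by positivity)))
          (h2.trans (mul_le_mul_of_nonneg_left hS (by positivity)))
    _ = 10 * 15367 := by rw [hsucc]; field_simp; ring
    _ ≤ 2 ^ 18 := by norm_num

/-- **The plain slice weight is NONNEGATIVE deep inside the class**: `klEdgeKappa·|Qm|_𝕋 ≤ Λ_{n+1} ⇒ 0 ≤ klSliceWeightPlain … (n+1) Qm p` (both bubbles have a line
on or above slice `n+1`). -/
theorem klSliceWeightPlain_succ_nonneg_of_deep (hK : FrameOK R U N μ K) (hβ : 0 < β) (n : ℕ) {Qm : TorusSite 2 L}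
    (hdeep : klEdgeKappa * klTorusNorm L Qm ≤ klScale klE0 (n + 1)) (p : TorusSite 2 L) : 0 ≤ klSliceWeightPlain L M β μ K (n + 1) Qm p := by
  rw [klSliceWeightPlain_succ_eq_bubbleMass]
  have hw : ∀ j (k : FreqMomentum L M), 0 ≤ hubbardCutoffWeightCT L M β μ K (klScale klE0 j) k := fun j k => (salmhoferCutoff_mem_Icc _).1
  have hs : ∀ k : FreqMomentum L M, 0 ≤ softSymbolCompl L M β μ K n (n + 1) k := fun k => (softSymbolCompl_succ_mem β μ K n k).1
  exact add_nonneg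
    (klBubbleMass_nonneg_of_hard_right β μ K hK hβ (hw n) hs (fun k hk => sq_le_of_softSymbolCompl_succ_ne_zero β μ K n hk) hdeep p)
    (klBubbleMass_nonneg_of_hard_left β μ K hK hβ hs (hw (n + 1)) (fun k hk => sq_le_of_softSymbolCompl_succ_ne_zero β μ K n hk) hdeep p)

/-- **SIGN LINE of the plain slice weight** (the (E2-F2) clause shape): `2^18 ≤ G.bhi ⇒ Σ_p (|w| − w) ≤ 2·klEdge G (n+1) |Qm|_𝕋` (`kled_negMass_clause`). -/
theorem sum_abs_sub_self_klSliceWeightPlain_succ_le (hK : FrameOK R U N μ K) (hβ : klBetaMin ≤ β) (hβL : β ≤ L) (n : ℕ) {G : GeoConsts}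
    (hG : (2 : ℝ) ^ 18 ≤ G.bhi) (Qm : TorusSite 2 L) :
    ∑ p, (|klSliceWeightPlain L M β μ K (n + 1) Qm p| - klSliceWeightPlain L M β μ K (n + 1) Qm p) ≤ 2 * klEdge G (n + 1) (klTorusNorm L Qm) :=
  kled_negMass_clause (le_trans (by positivity) hG) (KLProgrammeLegKernels.torusSupNorm_nonneg _)
    ((sum_abs_klSliceWeightPlain_succ_le β μ K hK hβ hβL n Qm).trans hG)
    fun h p => klSliceWeightPlain_succ_nonneg_of_deep β μ K hK (pos_of_klBetaMin_le hβ) n h.le p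

/-- The (E2-F2) mass conjunct shape: `2^18 ≤ G.bhi ⇒ Σ_p |klSliceWeightPlain … (n+1) Qm p| ≤ G.bhi`. -/
theorem sum_abs_klSliceWeightPlain_succ_le_bhi (hK : FrameOK R U N μ K) (hβ : klBetaMin ≤ β) (hβL : β ≤ L) (n : ℕ) {G : GeoConsts}
    (hG : (2 : ℝ) ^ 18 ≤ G.bhi) (Qm : TorusSite 2 L) : ∑ p, |klSliceWeightPlain L M β μ K (n + 1) Qm p| ≤ G.bhi :=
  (sum_abs_klSliceWeightPlain_succ_le β μ K hK hβ hβL n Qm).trans hG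

end Plain

/-! ## §4 The SMEARED slice weight `w₁^{(φ)}_{n+1} = B(s_{n+1}, φ + s_{n+1}) + B(φ, s_{n+1})` -/

section Smeared

variable {L M : ℕ} [NeZero L] (β μ : ℝ) (K : TrigPolyC4v)

omit [NeZero L] in
/-- At the top there is no slice: `klSliceWeightSmeared … 0 φ = 0`. -/
theorem klSliceWeightSmeared_zero (φ : FreqMomentum L M → ℝ) (Qm p : TorusSite 2 L) : klSliceWeightSmeared L M β μ K 0 φ Qm p = 0 := by
  have hs : softSymbolCompl L M β μ K (0 - 1) 0 = 0 := by funext k; simp [softSymbolCompl]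
  rw [klSliceWeightSmeared, hs, add_zero, sub_self]

omit [NeZero L] in
/-- **The smeared slice weight as two bubbles, one line the slice symbol**: `w₁^{(φ)}_{n+1} = B(s_{n+1}, φ + s_{n+1}) + B(φ, s_{n+1})`. -/
theorem klSliceWeightSmeared_succ_eq_bubbleMass (n : ℕ) (φ : FreqMomentum L M → ℝ) (Qm p : TorusSite 2 L) :
    klSliceWeightSmeared L M β μ K (n + 1) φ Qm p =
      klBubbleMass L M β μ K (softSymbolCompl L M β μ K n (n + 1)) (φ + softSymbolCompl L M β μ K n (n + 1)) Qm p +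
        klBubbleMass L M β μ K φ (softSymbolCompl L M β μ K n (n + 1)) Qm p := by
  rw [klSliceWeightSmeared, Nat.add_sub_cancel, klBubbleMass_add_left, klBubbleMass_add_right]
  ring

variable {R : RenConsts} {U : ℝ} {N : ℕ}

/-- **MASS LINE of the smeared slice weight**: on an admissible frame, `klBetaMin ≤ β ≤ L`, for every member symbol `0 ≤ φ ≤ 1 − w_{Λ_{n+1}}` of scale `n+1` and every `Qm`:
`Σ_p |klSliceWeightSmeared … (n+1) φ Qm p| ≤ 2^18` (`φ + s_{n+1}` is soft at scale `n`: `(2/Λ_{n+1})·15367Λ_n + (2/Λ_{n+1})·15367Λ_{n+1} = 10·15367`). -/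
theorem sum_abs_klSliceWeightSmeared_succ_le (hK : FrameOK R U N μ K) (hβ : klBetaMin ≤ β) (hβL : β ≤ L) (n : ℕ)
    {φ : FreqMomentum L M → ℝ} (hφ : ∀ k, 0 ≤ φ k ∧ φ k ≤ 1 - hubbardCutoffWeightCT L M β μ K (klScale klE0 (n + 1)) k) (Qm : TorusSite 2 L) :
    ∑ p, |klSliceWeightSmeared L M β μ K (n + 1) φ Qm p| ≤ 2 ^ 18 := by
  have hβ0 : 0 < β := pos_of_klBetaMin_le hβ
  have hL : (0 : ℝ) < L := lt_of_lt_of_le hβ0 hβL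
  have hΛ : 0 < klScale klE0 n := klth_klScale_pos n
  have hΛ' : 0 < klScale klE0 (n + 1) := klth_klScale_pos (n + 1)
  have hsucc : klScale klE0 (n + 1) = klScale klE0 n / 4 := klth_klScale_succ n
  -- `φ + s_{n+1}` is soft at scale `n`
  have hφs : ∀ k, 0 ≤ (φ + softSymbolCompl L M β μ K n (n + 1)) k ∧
      (φ + softSymbolCompl L M β μ K n (n + 1)) k ≤ 1 - hubbardCutoffWeightCT L M β μ K (klScale klE0 n) k := by
    intro k
    have h1 := hφ k
    have h2 := (softSymbolCompl_succ_mem β μ K n k).1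
    simp only [Pi.add_apply, softSymbolCompl] at h2 ⊢
    constructor <;> linarith
  have hS₀ := sum_softSymbol_mul_norm_propCT_le_of_frameOK (M := M) β μ K hK hβ hβL n hφs
  have hS₁ := sum_softSymbol_mul_norm_propCT_le_of_frameOK (M := M) β μ K hK hβ hβL (n + 1) hφ
  have hc : 0 ≤ (β * (L : ℝ) ^ 2)⁻¹ := by positivity
  have h1 := sum_abs_klBubbleMass_le_of_left β μ K hβ0 (φ + softSymbolCompl L M β μ K n (n + 1))
    (softSymbolCompl_succ_mul_norm_propCT_le β μ K n) Qm
  have h2 := sum_abs_klBubbleMass_le_of_right β μ K hβ0 φ (softSymbolCompl_succ_mul_norm_propCT_le β μ K n) Qm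
  have hne : β * (L : ℝ) ^ 2 ≠ 0 := by positivity
  calc ∑ p, |klSliceWeightSmeared L M β μ K (n + 1) φ Qm p|
      ≤ ∑ p, (|klBubbleMass L M β μ K (softSymbolCompl L M β μ K n (n + 1)) (φ + softSymbolCompl L M β μ K n (n + 1)) Qm p| +
          |klBubbleMass L M β μ K φ (softSymbolCompl L M β μ K n (n + 1)) Qm p|) :=
        sum_le_sum fun p _ => by rw [klSliceWeightSmeared_succ_eq_bubbleMass]; exact abs_add_le _ _
    _ ≤ (β * (L : ℝ) ^ 2)⁻¹ * (2 / klScale klE0 (n + 1)) * (15367 * klScale klE0 n * β * (L : ℝ) ^ 2) +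
          (β * (L : ℝ) ^ 2)⁻¹ * (2 / klScale klE0 (n + 1)) * (15367 * klScale klE0 (n + 1) * β * (L : ℝ) ^ 2) := by
        rw [sum_add_distrib]
        exact add_le_add (h1.trans (mul_le_mul_of_nonneg_left hS₀ (by positivity)))
          (h2.trans (mul_le_mul_of_nonneg_left hS₁ (by positivity)))
    _ = 10 * 15367 := by rw [hsucc]; field_simp; ring
    _ ≤ 2 ^ 18 := by norm_num

/-- **The smeared slice weight is NONNEGATIVE deep inside the class**: `0 ≤ φ`, `klEdgeKappa·|Qm|_𝕋 ≤ Λ_{n+1} ⇒ 0 ≤ klSliceWeightSmeared … (n+1) φ Qm p`. -/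
theorem klSliceWeightSmeared_succ_nonneg_of_deep (hK : FrameOK R U N μ K) (hβ : 0 < β) (n : ℕ) {φ : FreqMomentum L M → ℝ} (hφ0 : ∀ k, 0 ≤ φ k)
    {Qm : TorusSite 2 L} (hdeep : klEdgeKappa * klTorusNorm L Qm ≤ klScale klE0 (n + 1)) (p : TorusSite 2 L) :
    0 ≤ klSliceWeightSmeared L M β μ K (n + 1) φ Qm p := by
  rw [klSliceWeightSmeared_succ_eq_bubbleMass]
  have hs : ∀ k : FreqMomentum L M, 0 ≤ softSymbolCompl L M β μ K n (n + 1) k := fun k => (softSymbolCompl_succ_mem β μ K n k).1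
  have hφs : ∀ k : FreqMomentum L M, 0 ≤ (φ + softSymbolCompl L M β μ K n (n + 1)) k := fun k => add_nonneg (hφ0 k) (hs k)
  exact add_nonneg
    (klBubbleMass_nonneg_of_hard_left β μ K hK hβ hs hφs (fun k hk => sq_le_of_softSymbolCompl_succ_ne_zero β μ K n hk) hdeep p)
    (klBubbleMass_nonneg_of_hard_right β μ K hK hβ hφ0 hs (fun k hk => sq_le_of_softSymbolCompl_succ_ne_zero β μ K n hk) hdeep p)

/-- **SIGN LINE of the smeared slice weight**: `2^18 ≤ G.bhi ⇒ Σ_p (|w₁| − w₁) ≤ 2·klEdge G (n+1) |Qm|_𝕋` for every member symbol of scale `n+1`. -/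
theorem sum_abs_sub_self_klSliceWeightSmeared_succ_le (hK : FrameOK R U N μ K) (hβ : klBetaMin ≤ β) (hβL : β ≤ L) (n : ℕ)
    {φ : FreqMomentum L M → ℝ} (hφ : ∀ k, 0 ≤ φ k ∧ φ k ≤ 1 - hubbardCutoffWeightCT L M β μ K (klScale klE0 (n + 1)) k)
    {G : GeoConsts} (hG : (2 : ℝ) ^ 18 ≤ G.bhi) (Qm : TorusSite 2 L) :
    ∑ p, (|klSliceWeightSmeared L M β μ K (n + 1) φ Qm p| - klSliceWeightSmeared L M β μ K (n + 1) φ Qm p) ≤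
      2 * klEdge G (n + 1) (klTorusNorm L Qm) :=
  kled_negMass_clause (le_trans (by positivity) hG) (KLProgrammeLegKernels.torusSupNorm_nonneg _)
    ((sum_abs_klSliceWeightSmeared_succ_le β μ K hK hβ hβL n hφ Qm).trans hG)
    fun h p => klSliceWeightSmeared_succ_nonneg_of_deep β μ K hK (pos_of_klBetaMin_le hβ) n (fun k => (hφ k).1) h.le p

end Smeared

end Summit.HubbardSuperconductivity.HubbardSuperconductivity.Theorems.KLRegimeSplit

end
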